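import Summits.Schanuel.Schanuel.Theorems.RootDecomp1BTranscendencePackageFloor04

/-!
# `RootDecomp1BTranscendencePackageFloor` — part 05 of 05 (`RootDecomp1BTranscendencePackageFloor05`): §8 the VERDICTS in the model (`isInvolutiveExp_E₀`, …, `schanuelRankE_E₀_one`, `not_kleinPolarE_E₀`, `not_localSurplusBudgetE_E₀`, `not_tameDefectZeroStepE_E₀`, `not_schanuelRankE_E₀_two`, `not_schanuelE_E₀`); §9 `twistFloor`, `exp_side`; §10 `TranscendencePackage`, the headline `_false_without_extra_channel` theorems, `transcendencePackageFloor`, `transcendencePackage_exp_dictionary`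

See part 01 (`Summits.Schanuel.Schanuel.Theorems.RootDecomp1BTranscendencePackageFloor01`) for the overview of the port (decomp-schanuel lens-4, gens 16–17; `--supports stmt-Schanuel-24622`; sorry-free, standard axioms; nothing here proves Schanuel — rung 0).
-/

noncomputable section

open Complex

set_option linter.dupNamespace false

namespace Summit.Schanuel.Schanuel.Theorems.RootDecomp1BTranscendencePackageFloor

/-! ## §5′ Transcendence-degree toolkit, continued (private copy of tree folklore)

Private copy of `Literature.Barriers.Schanuel.one_le_trdeg_of_transcendental_mem` (same statement and proof). -/

/-- A transcendental element forces `trdeg ≥ 1` (private copy of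
`Literature.Barriers.Schanuel.one_le_trdeg_of_transcendental_mem`). [folklore] -/
private theorem one_le_trdeg_of_transcendental_mem {L : IntermediateField ℚ ℂ} {w : ℂ}
    (hw : w ∈ L) (ht : Transcendental ℚ w) : (1 : Cardinal) ≤ Algebra.trdeg ℚ L := by
  haveI : Algebra.Transcendental ℚ L :=
    ⟨⟨⟨w, hw⟩, fun h => ht (IntermediateField.isAlgebraic_iff.mp h)⟩⟩
  exact Cardinal.one_le_iff_pos.mpr (trdeg_pos ℚ L)

/-! ## §8 The verdicts in the model `E₀` -/

/-- (E1) for `E₀`: homomorphism onto `ℂˣ`, cyclic kernel `ℤτ` with `conj τ = −τ` and standard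
torsion, `conj`-equivariance, polar dictionary. [folklore] -/
theorem isInvolutiveExp_E₀ : IsInvolutiveExp E₀ where
  map_add := S₀.E_add
  surj := fun _ hw => S₀.E_surjective hw
  kernel := ⟨S₀.τ, S₀.τ_ne_zero, S₀.conj_τ, S₀.E_eq_one_iff, S₀.E_τ_div_natCast⟩
  map_conj := S₀.E_conj
  real_pos := S₀.E_ofReal_pos
  real_onto := fun _ ht => S₀.E_real_onto_pos ht
  imag_circle := S₀.norm_E_ofReal_mul_I
  imag_onto := fun _ hw => S₀.E_imag_onto_circle hw

/-- (E2) for `E₀`: agreement with `exp` on `ℚ̄` and `ℚ̄`-linear transport of logarithms (`θ = θ₀`).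
[folklore] -/
theorem agreesOnQbar_E₀ : AgreesOnQbar E₀ where
  eq_exp := fun _ hq => S₀.E_of_isAlgebraic hq
  transport := ⟨S₀.θ, S₀.θ_bijective, S₀.θ_one,
    fun _ z hq => S₀.θ_mul_of_mem (mem_Qb_iff.mpr hq) z, S₀.θ_add, fun _ => rfl⟩

/-- (E3) Hermite–Lindemann holds for `E₀`. [cite: Lindemann1882] -/
theorem hermiteLindemannE_E₀ : HermiteLindemannE E₀ := fun hα h0 => S₀.hermiteLindemann_E hα h0

/-- (E3) Lindemann–Weierstrass holds for `E₀`. [cite: Weierstrass1885] -/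
theorem lindemannWeierstrassE_E₀ : LindemannWeierstrassE E₀ :=
  fun α halg hli => S₀.lindemannWeierstrass_E α halg hli

/-- (E3) Gelfond–Schneider holds for `E₀`. [cite: Gelfond1934] -/
theorem gelfondSchneiderE_E₀ : GelfondSchneiderE E₀ :=
  fun ha hb hbq hl hl0 => S₀.gelfondSchneider_E ha hb hbq hl hl0

/-- (E3) Baker's theorem holds for `E₀`. [cite: Baker1966, 68] -/
theorem bakerE_E₀ : BakerE E₀ := fun l halg hli => S₀.baker_E l halg hli

/-- Rank one of Schanuel for ANY exponential with Hermite–Lindemann: HL plus the algebraic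
dichotomy. [folklore] -/
theorem schanuelRankE_one_of_HL (E : ℂ → ℂ) (hHL : HermiteLindemannE E) : SchanuelRankE E 1 := by
  intro y hy
  have hz : y 0 ≠ 0 := by
    have := linearIndependent_unique_iff.mp hy
    simpa using this
  have hmem : y 0 ∈ IntermediateField.adjoin ℚ (Set.range y ∪ Set.range (E ∘ y)) :=
    IntermediateField.subset_adjoin ℚ _ (Set.mem_union_left _ ⟨0, rfl⟩)
  have hmemE : E (y 0) ∈ IntermediateField.adjoin ℚ (Set.range y ∪ Set.range (E ∘ y)) :=
    IntermediateField.subset_adjoin ℚ _ (Set.mem_union_right _ ⟨0, rfl⟩)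
  by_cases halg : IsAlgebraic ℚ (y 0)
  · exact_mod_cast one_le_trdeg_of_transcendental_mem hmemE (hHL halg hz)
  · exact_mod_cast one_le_trdeg_of_transcendental_mem hmem halg

/-- `S_{E₀}(1)` holds. [folklore] -/
theorem schanuelRankE_E₀_one : SchanuelRankE E₀ 1 :=
  schanuelRankE_one_of_HL E₀ hermiteLindemannE_E₀

/-- KleinIH below length one is vacuous. [folklore] -/
theorem kleinIH_one (E : ℂ → ℂ) : ∀ k, k < 1 → ∀ (s : Fin k → ℝ), LinearIndependent ℚ s →
    ((k + k : ℕ) : Cardinal) ≤ Algebra.trdeg ℚ ↥(IntermediateField.adjoin ℚ (Set.range (Fin.append (fun j => ((s j : ℝ) : ℂ)) (fun j => ((s j : ℝ) : ℂ) * Complex.I)) ∪ Set.range (E ∘ Fin.append (fun j => ((s j : ℝ) : ℂ)) (fun j => ((s j : ℝ) : ℂ) * Complex.I)))) := by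
  intro k hk s _
  have : k = 0 := by omega
  subst this
  simp

/-- The polar generating set of `r = (u₀)` consists of elements algebraic over `K₀`. [folklore] -/
theorem polar_algebraic : ∀ x ∈ Set.range (Fin.append (fun j => (((![u₀] : Fin 1 → ℝ) j : ℝ) : ℂ)) (fun j => (((![u₀] : Fin 1 → ℝ) j : ℝ) : ℂ) * Complex.I)) ∪ Set.range (E₀ ∘ Fin.append (fun j => (((![u₀] : Fin 1 → ℝ) j : ℝ) : ℂ)) (fun j => (((![u₀] : Fin 1 → ℝ) j : ℝ) : ℂ) * Complex.I)), IsAlgebraic K₀ x := by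
  rintro x (⟨i, rfl⟩ | ⟨i, rfl⟩)
  · refine Fin.addCases (fun j => ?_) (fun j => ?_) i
    · rw [Fin.append_left]; simpa using alg_u₀
    · rw [Fin.append_right]; simpa using alg_u₀I
  · refine Fin.addCases (fun j => ?_) (fun j => ?_) i
    · simp only [Function.comp_apply]; rw [Fin.append_left]; simpa using alg_E₀u₀
    · simp only [Function.comp_apply]; rw [Fin.append_right]; simpa using alg_E₀u₀I

/-- **X(1) FAILS for `E₀`**: `trdeg ℚ(u₀, iu₀, E₀ u₀, E₀(iu₀)) = trdeg ℚ(u₀, iu₀, 2, 2^i) ≤ 1 < 2`.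
[folklore] -/
theorem not_kleinPolarE_E₀ : ¬ KleinPolarE E₀ := by
  intro h
  have h1 := (h 1 ![u₀] linearIndependent_u₀).trans (trdeg_le_one_of_forall polar_algebraic)
  norm_num at h1

/-- **LSB(1) FAILS for `E₀`**: `2·1 + trdeg ℚ(u₀) = 3 > 1 + 1`. [folklore] -/
theorem not_localSurplusBudgetE_E₀ : ¬ LocalSurplusBudgetE E₀ := by
  intro h
  have h1 := h 1 ![u₀] linearIndependent_u₀ (kleinIH_one E₀)
  have hA : (1 : Cardinal) ≤ Algebra.trdeg ℚ
      ↥(IntermediateField.adjoin ℚ (Set.range fun j => (((![u₀] : Fin 1 → ℝ) j : ℝ) : ℂ))) :=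
    one_le_trdeg_of_transcendental_mem
      (IntermediateField.subset_adjoin ℚ _ ⟨0, by simp⟩) transcendental_u₀
  have hB : Algebra.trdeg ℚ ↥(IntermediateField.adjoin ℚ (Set.range (fun j => (((![u₀] : Fin 1 → ℝ) j : ℝ) : ℂ)) ∪ Set.range (E₀ ∘ fun j => (((![u₀] : Fin 1 → ℝ) j : ℝ) : ℂ)))) ≤ 1 :=
    trdeg_le_one_of_forall (by
      rintro x (⟨j, rfl⟩ | ⟨j, rfl⟩)
      · simpa using alg_u₀
      · simpa using alg_E₀u₀)
  have hC : Algebra.trdeg ℚ ↥(IntermediateField.adjoin ℚ (Set.range (fun j => (((![u₀] : Fin 1 → ℝ) j : ℝ) : ℂ) * Complex.I) ∪ Set.range (E₀ ∘ fun j => (((![u₀] : Fin 1 → ℝ) j : ℝ) : ℂ) * Complex.I))) ≤ 1 :=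
    trdeg_le_one_of_forall (by
      rintro x (⟨j, rfl⟩ | ⟨j, rfl⟩)
      · simpa using alg_u₀I
      · simpa using alg_E₀u₀I)
  have h2 : ((1 + 1 : ℕ) : Cardinal) + 1 ≤ (1 : Cardinal) + 1 :=
    calc ((1 + 1 : ℕ) : Cardinal) + 1
        ≤ ((1 + 1 : ℕ) : Cardinal) + Algebra.trdeg ℚ ↥(IntermediateField.adjoin ℚ
            (Set.range fun j => (((![u₀] : Fin 1 → ℝ) j : ℝ) : ℂ))) := add_le_add le_rfl hA
      _ ≤ _ := h1
      _ ≤ (1 : Cardinal) + 1 := add_le_add hB hC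
  norm_num at h2

/-- **T0(0) FAILS for `E₀`**: `u₀` is tame for `E₀` (one relation: `u₀ = 2^i + 2^{-i}`), the
initial bound `t ≥ 1` holds, but `t(u₀) = 1 < 2`. [folklore] -/
theorem not_tameDefectZeroStepE_E₀ : ¬ TameDefectZeroStepE E₀ := by
  intro h
  have hu : (1 : Cardinal) ≤ Algebra.trdeg ℚ
      ↥(IntermediateField.adjoin ℚ (Set.range fun j => (((![u₀] : Fin (0 + 1) → ℝ) j : ℝ) : ℂ))) :=
    one_le_trdeg_of_transcendental_mem
      (IntermediateField.subset_adjoin ℚ _ ⟨0, by simp⟩) transcendental_u₀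
  have htame : Algebra.trdeg ℚ ↥(IntermediateField.adjoin ℚ (Set.range (fun j => (((![u₀] : Fin (0 + 1) → ℝ) j : ℝ) : ℂ)) ∪ {E₀ (((![u₀] : Fin (0 + 1) → ℝ) (Fin.last 0) : ℝ) : ℂ), E₀ ((((![u₀] : Fin (0 + 1) → ℝ) (Fin.last 0) : ℝ) : ℂ) * Complex.I)})) ≤ Algebra.trdeg ℚ ↥(IntermediateField.adjoin ℚ (Set.range (fun j => (((![u₀] : Fin (0 + 1) → ℝ) j : ℝ) : ℂ)))) + 1 := by
    refine (trdeg_le_one_of_forall ?_).trans le_add_self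
    rintro x (⟨j, rfl⟩ | hx)
    · simpa using alg_u₀
    · rcases hx with rfl | rfl
      · simpa using alg_E₀u₀
      · simpa using alg_E₀u₀I
  have hinit : ((0 + 0 + 1 : ℕ) : Cardinal) ≤ Algebra.trdeg ℚ ↥(IntermediateField.adjoin ℚ (Set.range (Fin.append (fun j => (((![u₀] : Fin (0 + 1) → ℝ) j : ℝ) : ℂ)) (fun j => (((![u₀] : Fin (0 + 1) → ℝ) j : ℝ) : ℂ) * Complex.I)) ∪ Set.range (E₀ ∘ Fin.append (fun j => (((![u₀] : Fin (0 + 1) → ℝ) j : ℝ) : ℂ)) (fun j => (((![u₀] : Fin (0 + 1) → ℝ) j : ℝ) : ℂ) * Complex.I)))) := by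
    have hmem : (u₀ : ℂ) ∈ Set.range (Fin.append (fun j => (((![u₀] : Fin (0 + 1) → ℝ) j : ℝ) : ℂ)) (fun j => (((![u₀] : Fin (0 + 1) → ℝ) j : ℝ) : ℂ) * Complex.I)) :=
      ⟨Fin.castAdd (0 + 1) 0, by rw [Fin.append_left]; simp⟩
    exact_mod_cast one_le_trdeg_of_transcendental_mem
      (IntermediateField.subset_adjoin ℚ _ (Set.mem_union_left _ hmem)) transcendental_u₀
  have h1 := (h 0 ![u₀] linearIndependent_u₀ (kleinIH_one E₀) htame hinit).trans
    (trdeg_le_one_of_forall polar_algebraic)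
  norm_num at h1

/-- The pair `(u₀, iu₀)` generates a field whose elements are algebraic over `K₀`. [folklore] -/
theorem pair_algebraic : ∀ x ∈ Set.range ![(u₀ : ℂ), (u₀ : ℂ) * I] ∪
    Set.range (E₀ ∘ ![(u₀ : ℂ), (u₀ : ℂ) * I]), IsAlgebraic K₀ x := by
  rintro x (⟨j, rfl⟩ | ⟨j, rfl⟩) <;> fin_cases j
  · simpa using alg_u₀
  · simpa using alg_u₀I
  · simpa using alg_E₀u₀
  · simpa using alg_E₀u₀I

/-- **S_{E₀}(2) FAILS** at the `ℚ`-free, conjugation-stable, polar pair `(u₀, iu₀)`; with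
`schanuelRankE_E₀_one` this pair is a FIRST failure of `S_{E₀}`. [folklore] -/
theorem not_schanuelRankE_E₀_two : ¬ SchanuelRankE E₀ 2 := by
  intro h
  have h1 := (h ![(u₀ : ℂ), (u₀ : ℂ) * I] linearIndependent_u₀_u₀I).trans
    (trdeg_le_one_of_forall pair_algebraic)
  norm_num at h1

/-- **The summit text FAILS for `E₀`.** [folklore] -/
theorem not_schanuelE_E₀ : ¬ SchanuelE E₀ := fun h => not_schanuelRankE_E₀_two (h 2)

/-! ## §9 TWIST FLOOR — the packaged statement -/

/-- **TWIST FLOOR.** There is an exponential `E` on `(ℂ, +, ·, conj, ℝ)` — a `conj`-equivariant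
surjective homomorphism onto `ℂˣ` with cyclic kernel `ℤτ` (`conj τ = -τ`, standard torsion) and the
polar dictionary `E(ℝ) = ℝ_{>0}`, `E(iℝ) = S¹` — which AGREES WITH `exp` ON `ℚ̄`, transports
logarithms `ℚ̄`-linearly, satisfies LINDEMANN–WEIERSTRASS, HERMITE–LINDEMANN, GELFOND–SCHNEIDER and
BAKER verbatim and Schanuel in rank `1`, and for which Klein-polar Schanuel at length `1`, the Local
Surplus Budget at length `1`, the tame defect-zero step at storey `0`, Schanuel in rank `2` and the
summit text all FAIL (at `u₀ = 2cos(log 2)`: `E u₀ = 2`, `E(iu₀) = 2^i`). Consequently none of these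
route statements follows from the listed properties of the exponential alone. [folklore] -/
theorem twistFloor :
    ∃ E : ℂ → ℂ, IsInvolutiveExp E ∧ AgreesOnQbar E ∧ LindemannWeierstrassE E ∧
      HermiteLindemannE E ∧ GelfondSchneiderE E ∧ BakerE E ∧ SchanuelRankE E 1 ∧
      ¬ KleinPolarE E ∧ ¬ LocalSurplusBudgetE E ∧ ¬ TameDefectZeroStepE E ∧
      ¬ SchanuelRankE E 2 ∧ ¬ SchanuelE E :=
  ⟨E₀, isInvolutiveExp_E₀, agreesOnQbar_E₀, lindemannWeierstrassE_E₀, hermiteLindemannE_E₀,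
    gelfondSchneiderE_E₀, bakerE_E₀, schanuelRankE_E₀_one, not_kleinPolarE_E₀,
    not_localSurplusBudgetE_E₀, not_tameDefectZeroStepE_E₀, not_schanuelRankE_E₀_two,
    not_schanuelE_E₀⟩

/-- The genuine exponential satisfies the same structural axioms (E1). [folklore] -/
theorem isInvolutiveExp_exp : IsInvolutiveExp cexp where
  map_add := Complex.exp_add
  surj := fun w hw => ⟨Complex.log w, Complex.exp_log hw⟩
  kernel := by
    refine ⟨2 * Real.pi * I, ?_, ?_, fun z => Complex.exp_eq_one_iff, fun n => rfl⟩
    · intro h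
      have h2 : (2 * (Real.pi : ℂ) * I).im = 0 := by rw [h]; simp
      simp [Real.pi_ne_zero] at h2
    · have h2 : (starRingEnd ℂ) (2 : ℂ) = 2 := by
        rw [show (2 : ℂ) = ((2 : ℝ) : ℂ) by norm_num, Complex.conj_ofReal]
      rw [map_mul, map_mul, h2, Complex.conj_ofReal, Complex.conj_I, mul_neg]
  map_conj := Complex.exp_conj
  real_pos := fun x => ⟨Real.exp x, Real.exp_pos x, (Complex.ofReal_exp x).symm⟩
  real_onto := fun t ht => ⟨Real.log t, by rw [← Complex.ofReal_exp, Real.exp_log ht]⟩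
  imag_circle := Complex.norm_exp_ofReal_mul_I
  imag_onto := fun w hw => ⟨Complex.arg w, by
    have h2 := Complex.norm_mul_exp_arg_mul_I w
    rw [hw] at h2
    simpa using h2⟩

/-- … and (E2), with `θ = id`. [folklore] -/
theorem agreesOnQbar_exp : AgreesOnQbar cexp where
  eq_exp := fun _ _ => rfl
  transport := ⟨id, Function.bijective_id, rfl, fun _ _ _ => rfl, fun _ _ => rfl, fun _ => rfl⟩

/-- The genuine exponential satisfies the whole package (E1)–(E4) (the four transcendence theorems
by the tree's `_holds` theorems, rank one by HL); at `E = exp` the five statements failing for `E₀` are the tree's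
`KleinPolarSchanuel`, `LocalSurplusBudget`, `TameDefectZeroStep` (route RootDecomp1B),
`SchanuelRank 2` and `Schanuel` (dictionary above) — conjecturally true. Hence none of them is a
consequence of the package. [cite: Baker1975, Theorems 1.2, 1.4 and 2.1] -/
theorem exp_side :
    IsInvolutiveExp cexp ∧ AgreesOnQbar cexp ∧ LindemannWeierstrassE cexp ∧ HermiteLindemannE cexp ∧
      GelfondSchneiderE cexp ∧ BakerE cexp ∧ SchanuelRankE cexp 1 :=
  ⟨isInvolutiveExp_exp, agreesOnQbar_exp,
    fun α h1 h2 => Literature.NumberTheory.Transcendental.algebraicIndependent_exp_holds α h1 h2,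
    fun h1 h2 => Literature.NumberTheory.Transcendental.transcendental_exp_holds h1 h2,
    fun h1 h2 h3 h4 h5 =>
      Literature.NumberTheory.Transcendental.gelfond_schneider_holds h1 h2 h3 h4 h5,
    fun l h1 h2 => Literature.NumberTheory.Transcendental.baker_holds l h1 h2,
    schanuelRankE_one_of_HL cexp
      fun h1 h2 => Literature.NumberTheory.Transcendental.transcendental_exp_holds h1 h2⟩

/-! ## §10 The package and the headline `_false_without_` statements -/

/-- **The algebraic-point transcendence package** of an exponential `E : ℂ → ℂ` (the name is
ours): (E1) `IsInvolutiveExp E`, (E2) `AgreesOnQbar E`, (E3) Lindemann–Weierstrass,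
Hermite–Lindemann, Gelfond–Schneider and Baker verbatim for `E`, (E4) Schanuel in rank one for `E`.
Satisfied by `exp` (`transcendencePackage_exp`) and by the sheared `E₀` (`transcendencePackage_E₀`).
[cite: Baker1975, Theorems 1.2, 1.4 and 2.1] -/
def TranscendencePackage (E : ℂ → ℂ) : Prop :=
  IsInvolutiveExp E ∧ AgreesOnQbar E ∧ LindemannWeierstrassE E ∧ HermiteLindemannE E ∧
    GelfondSchneiderE E ∧ BakerE E ∧ SchanuelRankE E 1

/-- `exp` satisfies the package (the four transcendence theorems by the tree's discharged facts,
rank one by Hermite–Lindemann). [cite: Baker1975, Theorems 1.2, 1.4 and 2.1] -/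
theorem transcendencePackage_exp : TranscendencePackage cexp := exp_side

/-- The sheared exponential `E₀` satisfies the package. [folklore] -/
theorem transcendencePackage_E₀ : TranscendencePackage E₀ :=
  ⟨isInvolutiveExp_E₀, agreesOnQbar_E₀, lindemannWeierstrassE_E₀, hermiteLindemannE_E₀,
    gelfondSchneiderE_E₀, bakerE_E₀, schanuelRankE_E₀_one⟩

/-- … but the package together with continuity on `ℝ` already excludes `E₀`: the evasion is any
use of `exp` at transcendental real arguments. [folklore] -/
theorem transcendencePackage_E₀_not_continuous :
    TranscendencePackage E₀ ∧ ¬ Continuous fun x : ℝ => E₀ x :=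
  ⟨transcendencePackage_E₀, not_continuous_E₀_real⟩

/-- **`KleinPolarSchanuel` is FALSE WITHOUT an extra channel**: it is not the case that every
exponential `E : ℂ → ℂ` with the algebraic-point transcendence package satisfies Klein-polar
Schanuel — the sheared `E₀` has the package and violates it at length `1` (`r = (u₀)`). Any proof of
the crux (`= KleinPolarE cexp`, `kleinPolarE_exp_iff`) must therefore use a property of `exp` outside
(E1)–(E4). [folklore] -/
theorem kleinPolarSchanuel_false_without_extra_channel :
    ¬ ∀ E : ℂ → ℂ, TranscendencePackage E → KleinPolarE E :=
  fun h => not_kleinPolarE_E₀ (h _ transcendencePackage_E₀)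

/-- **`LocalSurplusBudget` (length `1`) is FALSE WITHOUT an extra channel.** [folklore] -/
theorem localSurplusBudget_false_without_extra_channel :
    ¬ ∀ E : ℂ → ℂ, TranscendencePackage E → LocalSurplusBudgetE E :=
  fun h => not_localSurplusBudgetE_E₀ (h _ transcendencePackage_E₀)

/-- **`TameDefectZeroStep` (storey `0`) is FALSE WITHOUT an extra channel.** [folklore] -/
theorem tameDefectZeroStep_false_without_extra_channel :
    ¬ ∀ E : ℂ → ℂ, TranscendencePackage E → TameDefectZeroStepE E :=
  fun h => not_tameDefectZeroStepE_E₀ (h _ transcendencePackage_E₀)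

/-- **`SchanuelRank 2` is FALSE WITHOUT an extra channel** (at a `ℚ`-free, `conj`-stable polar pair).
[cite: Roy2001, §1] -/
theorem schanuelRank_two_false_without_extra_channel :
    ¬ ∀ E : ℂ → ℂ, TranscendencePackage E → SchanuelRankE E 2 :=
  fun h => not_schanuelRankE_E₀_two (h _ transcendencePackage_E₀)

/-- **The summit text is FALSE WITHOUT an extra channel.** [cite: Waldschmidt2000, §1.4] -/
theorem schanuel_false_without_extra_channel :
    ¬ ∀ E : ℂ → ℂ, TranscendencePackage E → SchanuelE E :=
  fun h => not_schanuelE_E₀ (h _ transcendencePackage_E₀)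

/-- **TRANSCENDENCE PACKAGE FLOOR** (existence form): an exponential on `ℂ` with the package for
which the `E`-forms of `KleinPolarSchanuel`, `LocalSurplusBudget`, `TameDefectZeroStep`,
`SchanuelRank 2` and `Schanuel` all fail. [folklore] -/
theorem transcendencePackageFloor :
    ∃ E : ℂ → ℂ, TranscendencePackage E ∧ ¬ KleinPolarE E ∧ ¬ LocalSurplusBudgetE E ∧
      ¬ TameDefectZeroStepE E ∧ ¬ SchanuelRankE E 2 ∧ ¬ SchanuelE E :=
  ⟨E₀, transcendencePackage_E₀, not_kleinPolarE_E₀, not_localSurplusBudgetE_E₀,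
    not_tameDefectZeroStepE_E₀, not_schanuelRankE_E₀_two, not_schanuelE_E₀⟩

/-- The genuine exponential has the package, and its instances of the five statements ARE the route
items `KleinPolarSchanuel`, `LocalSurplusBudget`, `TameDefectZeroStep`, the tree's `SchanuelRank 2`
and the summit `Schanuel` (`Iff.rfl`) — so none of them is a consequence of the package.
[cite: Baker1975, Theorems 1.2, 1.4 and 2.1] -/
theorem transcendencePackage_exp_dictionary :
    TranscendencePackage cexp ∧
      (KleinPolarE cexp ↔ Summit.Schanuel.Schanuel.Theses.RootDecomp1B.KleinPolarSchanuel) ∧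
      (LocalSurplusBudgetE cexp ↔ Summit.Schanuel.Schanuel.Theses.RootDecomp1B.LocalSurplusBudget) ∧
      (TameDefectZeroStepE cexp ↔ Summit.Schanuel.Schanuel.Theses.RootDecomp1B.TameDefectZeroStep) ∧
      (SchanuelRankE cexp 2 ↔ Literature.NumberTheory.Transcendental.SchanuelRank 2) ∧
      (SchanuelE cexp ↔ Schanuel) :=
  ⟨transcendencePackage_exp, kleinPolarE_exp_iff, localSurplusBudgetE_exp_iff,
    tameDefectZeroStepE_exp_iff, schanuelRankE_exp_iff 2, schanuelE_exp_iff⟩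

end Summit.Schanuel.Schanuel.Theorems.RootDecomp1BTranscendencePackageFloor

end
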